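import Literature.Combinatorics.SimpleGraph.HamiltonianPathCount
import Mathlib.Data.List.Range
import Mathlib.Data.Fintype.Pi
import Mathlib.Order.Interval.Finset.Nat
import HarnessLib

/-!
# The diamond chain: a skeleton whose Hamiltonian paths are the bit vectors

The base graph ("skeleton") for the gadget substitutions of the `#3SAT → #HamPath` construction:
a chain of `N` **cells**, cell `i` consisting of the vertices `5i` (connector `c`), `5i+1` (`p`),
`5i+2` (`a`), `5i+3` (`b`), `5i+4` (`q`) with the edges `c–p, p–a, p–b, a–b, a–q, b–q` and `q–c'`
to the connector of the next cell (`chainG N` on `chainV N = {0, …, 5N-1}`). A Hamiltonian path from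
`s = 0` to `t = 5N-1` traverses the cells in order and each cell `i` either as `c p a b q`
(`σ i = true`) or as `c p b a q` (`σ i = false`): **the Hamiltonian `s`–`t` paths are exactly the
`2^N` paths `pathOf N σ`** (`isHamPathOn_iff`), and which of the four "slot" edges
`p–a, b–q` (state `true`) and `p–b, a–q` (state `false`) of a cell a path uses is read off `σ`
(`uses_pathOf_pa` …). Hence the constrained counts `hamCountRF` of the skeleton are numbers of bit
vectors (`hamCountRF_chain_eq_card`). The proof is the cut-vertex decomposition of a Hamiltonian path
at a vertex of degree two (`IsHamPathOn.split`, stated for any graph) and induction on `N`.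

## References

* M. R. Garey, D. S. Johnson, R. E. Tarjan, SIAM J. Comput. 5 (1976) 704–714, §2.
* C. H. Papadimitriou, *Computational Complexity*, Addison–Wesley 1994, §9.2 (choice gadgets of
  the Hamiltonian path reduction).
-/

namespace Literature.Combinatorics.SimpleGraph

/-! ### Cutting a Hamiltonian path at a cut vertex -/

section split

variable {α : Type*}

/-- Along a chain, a property preserved by the relation holds everywhere if it holds at the start.
[folklore] -/
theorem forall_mem_of_isChain_cons {R : α → α → Prop} {P : α → Prop} :
    ∀ {a : α} {l : List α}, List.IsChain R (a :: l) → P a →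
      (∀ u v, R u v → P u → v ∈ a :: l → P v) → ∀ x ∈ a :: l, P x
  | a, [], _, ha, _ => by simpa using ha
  | a, b :: l, hc, ha, hstep => by
    intro x hx
    rcases List.mem_cons.1 hx with rfl | hx
    · exact ha
    · have hab : R a b := (List.isChain_cons_cons.1 hc).1
      have hb : P b := hstep a b hab ha (by simp)
      exact forall_mem_of_isChain_cons (List.isChain_cons_cons.1 hc).2 hb
        (fun u v huv hu hv => hstep u v huv hu (List.mem_cons_of_mem _ hv)) x hx

/-- **Cutting a Hamiltonian path at a cut vertex.** If `V = A ⊔ {c} ⊔ B` with `s ∈ A`, `t ∈ B` and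
no edge between `A` and `B`, a Hamiltonian `s`–`t` path is a Hamiltonian path of `A` from `s`, then
`c`, then a Hamiltonian path of `B` to `t`. [folklore] -/
theorem IsHamPathOn.split [DecidableEq α] {G : _root_.SimpleGraph α} {V A B : Finset α} {c s t : α} {l : List α}
    (h : IsHamPathOn G V s t l) (hV : ∀ v, v ∈ V ↔ v ∈ A ∨ v = c ∨ v ∈ B) (hAB : Disjoint A B)
    (hcA : c ∉ A) (hcB : c ∉ B) (hs : s ∈ A) (ht : t ∈ B) (hno : ∀ a ∈ A, ∀ b ∈ B, ¬ G.Adj a b) :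
    ∃ l₁ l₂ x y, l = l₁ ++ c :: l₂ ∧ IsHamPathOn G A s x l₁ ∧ IsHamPathOn G B y t l₂ ∧ G.Adj x c ∧ G.Adj c y := by
  obtain ⟨hnd, hV', hhead, hlast, hchain⟩ := h
  have hcl : c ∈ l := by rw [← List.mem_toFinset, hV']; exact (hV c).2 (Or.inr (Or.inl rfl))
  obtain ⟨l₁, l₂, rfl⟩ := List.append_of_mem hcl
  -- the two pieces are nonempty
  have h1 : l₁ ≠ [] := by
    rintro rfl
    simp only [List.nil_append, List.head?_cons, Option.some.injEq] at hhead
    exact hcA (hhead ▸ hs)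
  have h2 : l₂ ≠ [] := by
    rintro rfl
    rw [List.getLast?_append, List.getLast?_singleton, Option.some_or, Option.some.injEq] at hlast
    exact hcB (hlast ▸ ht)
  -- chains
  rw [List.isChain_append] at hchain
  obtain ⟨hc1, hc2, hlink⟩ := hchain
  have hx : G.Adj (l₁.getLast h1) c := hlink _ (List.getLast?_eq_some_getLast h1 ▸ rfl) c rfl
  have hy : ∀ (h : l₂ ≠ []), G.Adj c (l₂.head h) ∧ List.IsChain G.Adj l₂ := by
    obtain ⟨y, r, rfl⟩ := List.exists_cons_of_ne_nil h2
    intro h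
    exact List.isChain_cons_cons.1 hc2
  obtain ⟨hy, hc2'⟩ := hy h2
  -- membership in `V` minus `c`
  have hmemV : ∀ v, v ∈ l₁ ∨ v ∈ l₂ → v ∈ A ∨ v ∈ B := by
    intro v hv
    have hvl : v ∈ l₁ ++ c :: l₂ := by
      rcases hv with hv | hv
      · exact List.mem_append_left _ hv
      · exact List.mem_append_right _ (List.mem_cons_of_mem _ hv)
    have hvc : v ≠ c := by
      rintro rfl
      rw [List.nodup_append] at hnd
      rcases hv with hv | hv
      · exact hnd.2.2 _ hv _ List.mem_cons_self rfl
      · exact (List.nodup_cons.1 hnd.2.1).1 hv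
    rcases (hV v).1 (by rw [← hV']; exact List.mem_toFinset.2 hvl) with h | h | h
    · exact Or.inl h
    · exact absurd h hvc
    · exact Or.inr h
  -- `l₁ ⊆ A`
  have hhead1 : l₁.head? = some s := by
    obtain ⟨u, r, hu⟩ := List.exists_cons_of_ne_nil h1
    rw [hu] at hhead ⊢
    simpa using hhead
  have hA : ∀ v ∈ l₁, v ∈ A := by
    obtain ⟨u₀, r, hl₁⟩ := List.exists_cons_of_ne_nil h1
    rw [hl₁] at hhead1 hc1 ⊢
    simp only [List.head?_cons, Option.some.injEq] at hhead1
    subst hhead1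
    refine forall_mem_of_isChain_cons hc1 hs fun u v huv hu hv => ?_
    rcases hmemV v (Or.inl (hl₁ ▸ hv)) with h | h
    · exact h
    · exact absurd huv (hno u hu v h)
  -- `l₂ ⊆ B` (walk backwards from `t`)
  have hlast2 : l₂.getLast? = some t := by
    rw [List.getLast?_append] at hlast
    cases hl : l₂.getLast? with
    | none => exact absurd (List.getLast?_eq_none_iff.1 hl) h2
    | some v =>
      rw [List.getLast?_cons, hl] at hlast
      simpa using hlast
  have hB : ∀ v ∈ l₂, v ∈ B := by
    have hrev : List.IsChain G.Adj l₂.reverse := List.isChain_reverse.2 (hc2'.imp fun _ _ h => h.symm)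
    obtain ⟨u₀, r, hl₂⟩ := List.exists_cons_of_ne_nil (List.reverse_ne_nil_iff.2 h2)
    have hut : u₀ = t := by
      have : l₂.reverse.head? = some t := by rw [List.head?_reverse]; exact hlast2
      rw [hl₂] at this
      simpa using this
    subst hut
    intro v hv
    rw [hl₂] at hrev
    refine forall_mem_of_isChain_cons hrev ht (fun u v huv hu hv => ?_) v (by rw [← hl₂]; exact List.mem_reverse.2 hv)
    rcases hmemV v (Or.inr (List.mem_reverse.1 (hl₂ ▸ hv))) with h | h
    · exact absurd huv.symm (hno v h u hu)
    · exact h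
  -- assemble
  refine ⟨l₁, l₂, l₁.getLast h1, l₂.head h2, rfl, ⟨hnd.of_append_left, ?_, hhead1, List.getLast?_eq_some_getLast h1, hc1⟩,
    ⟨(hnd.of_append_right).of_cons, ?_, List.head?_eq_some_head h2, hlast2, hc2'⟩, hx, hy⟩
  · ext v
    simp only [List.mem_toFinset]
    refine ⟨hA v, fun hv => ?_⟩
    have hvl : v ∈ l₁ ++ c :: l₂ := by
      rw [← List.mem_toFinset, hV']; exact (hV v).2 (Or.inl hv)
    rcases List.mem_append.1 hvl with h | h
    · exact h
    · rcases List.mem_cons.1 h with rfl | h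
      · exact absurd hv hcA
      · exact absurd hv (Finset.disjoint_left.1 hAB · (hB v h))
  · ext v
    simp only [List.mem_toFinset]
    refine ⟨hB v, fun hv => ?_⟩
    have hvl : v ∈ l₁ ++ c :: l₂ := by
      rw [← List.mem_toFinset, hV']; exact (hV v).2 (Or.inr (Or.inr hv))
    rcases List.mem_append.1 hvl with h | h
    · exact absurd (hA v h) (Finset.disjoint_right.1 hAB hv)
    · rcases List.mem_cons.1 h with rfl | h
      · exact absurd hv hcB
      · exact h

/-- A Hamiltonian path of a four-element set `{p, a, b, q}` from `p` to `q` is `p a b q` or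
`p b a q`. [folklore] -/
theorem IsHamPathOn.eq_of_card_four [DecidableEq α] {G : _root_.SimpleGraph α} {V : Finset α} {p a b q : α} {l : List α}
    (h : IsHamPathOn G V p q l) (hV : V = {p, a, b, q}) (hpa : p ≠ a) (hpb : p ≠ b) (hpq : p ≠ q) (hab : a ≠ b)
    (haq : a ≠ q) (hbq : b ≠ q) : l = [p, a, b, q] ∨ l = [p, b, a, q] := by
  obtain ⟨hnd, hV', hhead, hlast, -⟩ := h
  have hlen : l.length = 4 := by
    rw [← List.toFinset_card_of_nodup hnd, hV', hV]
    rw [Finset.card_insert_of_notMem (by simp [hpa, hpb, hpq]), Finset.card_insert_of_notMem (by simp [hab, haq]),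
      Finset.card_pair hbq]
  -- write `l = [u₀, u₁, u₂, u₃]`
  obtain ⟨u₀, u₁, u₂, u₃, rfl⟩ : ∃ u₀ u₁ u₂ u₃, l = [u₀, u₁, u₂, u₃] := by
    match l, hlen with
    | [u₀, u₁, u₂, u₃], _ => exact ⟨u₀, u₁, u₂, u₃, rfl⟩
  simp only [List.head?_cons, Option.some.injEq] at hhead
  simp only [List.getLast?_cons_cons, List.getLast?_singleton, Option.some.injEq] at hlast
  subst hhead; subst hlast
  have hmem : ∀ v ∈ [u₀, u₁, u₂, u₃], v ∈ ({u₀, a, b, u₃} : Finset α) := fun v hv => by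
    rw [← hV, ← hV']; exact List.mem_toFinset.2 hv
  have h1 := hmem u₁ (by simp)
  have h2 := hmem u₂ (by simp)
  simp only [List.nodup_cons, List.mem_cons, List.not_mem_nil, or_false, not_or, List.nodup_nil, and_true,
    not_false_eq_true] at hnd
  obtain ⟨⟨h01, h02, h03⟩, ⟨h12, h13⟩, h23⟩ := hnd
  simp only [Finset.mem_insert, Finset.mem_singleton] at h1 h2
  rcases h1 with h1 | h1 | h1 | h1
  · exact absurd h1.symm h01
  · rcases h2 with h2 | h2 | h2 | h2
    · exact absurd h2.symm h02
    · exact absurd (h1.trans h2.symm) h12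
    · left; rw [h1, h2]
    · exact absurd h2 h23
  · rcases h2 with h2 | h2 | h2 | h2
    · exact absurd h2.symm h02
    · right; rw [h1, h2]
    · exact absurd (h1.trans h2.symm) h12
    · exact absurd h2 h23
  · exact absurd h1 h13

end split

/-! ### The diamond chain -/

/-- The edges of the chain of `N` cells, as a Boolean relation (symmetrised below): within cell `i`
(`5i = c, 5i+1 = p, 5i+2 = a, 5i+3 = b, 5i+4 = q`) the edges `c–p, p–a, p–b, a–b, a–q, b–q`, and `q`
to the next connector. [folklore] -/
def chainRelB (N u v : ℕ) : Bool :=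
  (v < 5 * N) &&
    ((u % 5 == 0 && v == u + 1) || (u % 5 == 1 && (v == u + 1 || v == u + 2)) ||
      (u % 5 == 2 && (v == u + 1 || v == u + 2)) || (u % 5 == 3 && v == u + 1) || (u % 5 == 4 && v == u + 1))

/-- **The diamond chain with `N` cells.** [folklore] -/
def chainG (N : ℕ) : _root_.SimpleGraph ℕ :=
  _root_.SimpleGraph.fromRel fun u v => chainRelB N u v = true

/-- Adjacency in the chain is decidable. [folklore] -/
instance (N : ℕ) : DecidableRel (chainG N).Adj := fun a b =>
  inferInstanceAs (Decidable (a ≠ b ∧ (chainRelB N a b = true ∨ chainRelB N b a = true)))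

/-- The vertices of the chain: `0, …, 5N-1`. [folklore] -/
def chainV (N : ℕ) : Finset ℕ :=
  Finset.range (5 * N)

/-- Adjacency in the chain, unfolded. [folklore] -/
theorem chainG_adj {N u v : ℕ} : (chainG N).Adj u v ↔ u ≠ v ∧ (chainRelB N u v = true ∨ chainRelB N v u = true) :=
  _root_.SimpleGraph.fromRel_adj _ _ _

/-- The directed edge table, unfolded arithmetically. [folklore] -/
theorem chainRelB_iff {N u v : ℕ} : chainRelB N u v = true ↔ v < 5 * N ∧
    ((u % 5 = 0 ∧ v = u + 1) ∨ (u % 5 = 1 ∧ (v = u + 1 ∨ v = u + 2)) ∨ (u % 5 = 2 ∧ (v = u + 1 ∨ v = u + 2)) ∨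
      (u % 5 = 3 ∧ v = u + 1) ∨ (u % 5 = 4 ∧ v = u + 1)) := by
  simp [chainRelB, or_assoc]

/-- Adjacent vertices of the chain differ by one or two. [folklore] -/
theorem chainG_adj_bound {N u v : ℕ} (h : (chainG N).Adj u v) : u < 5 * N ∧ v < 5 * N ∧ (v = u + 1 ∨ v = u + 2 ∨ u = v + 1 ∨ u = v + 2) := by
  rw [chainG_adj] at h
  obtain ⟨hne, h | h⟩ := h <;> rw [chainRelB_iff] at h <;> omega

/-- The chain with more cells restricts to the chain on the first `5N` vertices. [folklore] -/
theorem chainG_adj_mono {N N' u v : ℕ} (hN : N ≤ N') (hu : u < 5 * N) (hv : v < 5 * N) :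
    (chainG N).Adj u v ↔ (chainG N').Adj u v := by
  rw [chainG_adj, chainG_adj, chainRelB_iff, chainRelB_iff, chainRelB_iff, chainRelB_iff]
  constructor
  · rintro ⟨hne, h | h⟩
    · exact ⟨hne, Or.inl ⟨by omega, h.2⟩⟩
    · exact ⟨hne, Or.inr ⟨by omega, h.2⟩⟩
  · rintro ⟨hne, h | h⟩
    · exact ⟨hne, Or.inl ⟨hv, h.2⟩⟩
    · exact ⟨hne, Or.inr ⟨hu, h.2⟩⟩

/-! ### The canonical paths -/

/-- The position permutation of a state vector: within cell `i` the positions `5i+2, 5i+3` of `a, b`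
are swapped when `σ i = false`. [folklore] -/
def chainPerm (σ : ℕ → Bool) (j : ℕ) : ℕ :=
  if j % 5 = 2 then (if σ (j / 5) then j else j + 1)
  else if j % 5 = 3 then (if σ (j / 5) then j else j - 1) else j

/-- **The path of the state vector `σ`**: cell `i` traversed as `c p a b q` if `σ i`, as `c p b a q`
otherwise. [folklore] -/
def pathOf (N : ℕ) (σ : ℕ → Bool) : List ℕ :=
  (List.range (5 * N)).map (chainPerm σ)

/-- The position permutation preserves the cell index. [folklore] -/
theorem chainPerm_div (σ : ℕ → Bool) (j : ℕ) : chainPerm σ j / 5 = j / 5 := by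
  unfold chainPerm
  split_ifs <;> omega

/-- The position permutation fixes a position or swaps it with its neighbour inside the cell. [folklore] -/
theorem chainPerm_cases (σ : ℕ → Bool) (j : ℕ) :
    chainPerm σ j = j ∨ (j % 5 = 2 ∧ σ (j / 5) = false ∧ chainPerm σ j = j + 1) ∨
      (j % 5 = 3 ∧ σ (j / 5) = false ∧ chainPerm σ j = j - 1) := by
  unfold chainPerm
  split_ifs with h1 h2 h3 h4
  · exact Or.inl rfl
  · exact Or.inr (Or.inl ⟨h1, by simpa using h2, rfl⟩)
  · exact Or.inl rfl
  · exact Or.inr (Or.inr ⟨h3, by simpa using h4, rfl⟩)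
  · exact Or.inl rfl

/-- The position permutation is an involution. [folklore] -/
theorem chainPerm_chainPerm (σ : ℕ → Bool) (j : ℕ) : chainPerm σ (chainPerm σ j) = j := by
  rcases chainPerm_cases σ j with h | ⟨h1, h2, h⟩ | ⟨h1, h2, h⟩
  · rw [h, h]
  · rw [h]
    unfold chainPerm
    have : (j + 1) % 5 = 3 := by omega
    have hd : (j + 1) / 5 = j / 5 := by omega
    rw [if_neg (by omega), if_pos this, hd, h2]
    simp
  · rw [h]
    unfold chainPerm
    have : (j - 1) % 5 = 2 := by omega
    have hd : (j - 1) / 5 = j / 5 := by omega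
    rw [if_pos this, hd, h2]
    simp only [Bool.false_eq_true, ↓reduceIte]
    omega

/-- The position permutation is injective. [folklore] -/
theorem chainPerm_injective (σ : ℕ → Bool) : Function.Injective (chainPerm σ) :=
  Function.LeftInverse.injective (chainPerm_chainPerm σ)

/-- The position permutation preserves each cell, hence the range `[0, 5N)`. [folklore] -/
theorem chainPerm_lt_iff (σ : ℕ → Bool) (N j : ℕ) : chainPerm σ j < 5 * N ↔ j < 5 * N := by
  have := chainPerm_div σ j
  constructor <;> intro h <;> omega

/-- The path of a state vector has `5N` entries. [folklore] -/
theorem length_pathOf (N : ℕ) (σ : ℕ → Bool) : (pathOf N σ).length = 5 * N := by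
  simp [pathOf]

/-- The entries of the path of a state vector. [folklore] -/
theorem getElem_pathOf {N : ℕ} {σ : ℕ → Bool} {j : ℕ} (hj : j < (pathOf N σ).length) :
    (pathOf N σ)[j] = chainPerm σ j := by
  simp [pathOf]

/-- The path of a state vector visits exactly `0, …, 5N-1`. [folklore] -/
theorem mem_pathOf_iff {N : ℕ} {σ : ℕ → Bool} {v : ℕ} : v ∈ pathOf N σ ↔ v < 5 * N := by
  simp only [pathOf, List.mem_map, List.mem_range]
  constructor
  · rintro ⟨j, hj, rfl⟩
    exact (chainPerm_lt_iff σ N j).2 hj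
  · intro hv
    exact ⟨chainPerm σ v, (chainPerm_lt_iff σ N v).2 hv, chainPerm_chainPerm σ v⟩

/-- The path of a state vector has distinct entries. [folklore] -/
theorem nodup_pathOf (N : ℕ) (σ : ℕ → Bool) : (pathOf N σ).Nodup :=
  (List.nodup_range).map (chainPerm_injective σ)

/-- Consecutive positions are sent to adjacent vertices. [folklore] -/
theorem chainG_adj_chainPerm_succ (σ : ℕ → Bool) {N j : ℕ} (hj : j + 1 < 5 * N) :
    (chainG N).Adj (chainPerm σ j) (chainPerm σ (j + 1)) := by
  rw [chainG_adj, chainRelB_iff, chainRelB_iff]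
  by_cases h4 : j % 5 = 4
  · have e1 : chainPerm σ j = j := by unfold chainPerm; rw [if_neg (by omega), if_neg (by omega)]
    have e2 : chainPerm σ (j + 1) = j + 1 := by unfold chainPerm; rw [if_neg (by omega), if_neg (by omega)]
    rw [e1, e2]; omega
  · have hd : (j + 1) / 5 = j / 5 := by omega
    unfold chainPerm
    rw [hd]
    cases σ (j / 5) <;> simp only [Bool.false_eq_true, ↓reduceIte] <;> split_ifs <;> omega

/-- Consecutive entries of the path of a state vector are adjacent. [folklore] -/
theorem isChain_pathOf (N : ℕ) (σ : ℕ → Bool) : List.IsChain (chainG N).Adj (pathOf N σ) := by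
  unfold pathOf
  rw [List.isChain_map]
  cases h : 5 * N with
  | zero => simp
  | succ n =>
    rw [List.isChain_range_succ]
    intro j hj
    exact chainG_adj_chainPerm_succ σ (by omega)

/-- **The path of every state vector is a Hamiltonian `s`–`t` path of the chain.** [folklore] -/
theorem isHamPathOn_pathOf {N : ℕ} (hN : 0 < N) (σ : ℕ → Bool) :
    IsHamPathOn (chainG N) (chainV N) 0 (5 * N - 1) (pathOf N σ) := by
  refine ⟨nodup_pathOf N σ, ?_, ?_, ?_, isChain_pathOf N σ⟩
  · ext v
    rw [List.mem_toFinset, mem_pathOf_iff, chainV, Finset.mem_range]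
  · rw [List.head?_eq_getElem?, List.getElem?_eq_getElem (by rw [length_pathOf]; omega), getElem_pathOf]
    simp [chainPerm]
  · rw [List.getLast?_eq_getElem?, List.getElem?_eq_getElem (by rw [length_pathOf]; omega), getElem_pathOf,
      length_pathOf]
    unfold chainPerm
    rw [if_neg (by omega), if_neg (by omega)]

/-! ### Every Hamiltonian path of the chain is the path of a state vector -/

/-- A state vector on `Fin N`, extended by `true`. [folklore] -/
def extB {N : ℕ} (σ : Fin N → Bool) (j : ℕ) : Bool :=
  if h : j < N then σ ⟨j, h⟩ else true

/-- The path depends only on the states of the cells. [folklore] -/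
theorem pathOf_congr {N : ℕ} {τ τ' : ℕ → Bool} (h : ∀ i < N, τ i = τ' i) : pathOf N τ = pathOf N τ' := by
  unfold pathOf
  apply List.map_congr_left
  intro j hj
  rw [List.mem_range] at hj
  unfold chainPerm
  rw [h (j / 5) (by omega)]

/-- The path of `N + 1` cells: the path of `N` cells followed by the last cell. [folklore] -/
theorem pathOf_succ (N : ℕ) (τ : ℕ → Bool) :
    pathOf (N + 1) τ = pathOf N τ ++ (5 * N) :: (5 * N + 1) ::
      ((if τ N then [5 * N + 2, 5 * N + 3] else [5 * N + 3, 5 * N + 2]) ++ [5 * N + 4]) := by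
  unfold pathOf
  rw [show 5 * (N + 1) = 5 * N + 5 by omega, List.range_add, List.map_append]
  congr 1
  have hd : ∀ r < 5, (5 * N + r) / 5 = N := fun r hr => by omega
  have hm : ∀ r < 5, (5 * N + r) % 5 = r := fun r hr => by omega
  cases hτ : τ N <;>
    simp [List.range_succ, chainPerm, hd, hm, hτ]

/-- The only neighbour of a connector on its left is the preceding `q`. [folklore] -/
theorem eq_of_adj_connector_left {N' N x : ℕ} (hx : x < 5 * N) (h : (chainG N').Adj x (5 * N)) : x = 5 * N - 1 := by
  rw [chainG_adj, chainRelB_iff, chainRelB_iff] at h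
  omega

/-- The only neighbour of a connector on its right is the following `p`. [folklore] -/
theorem eq_of_adj_connector_right {N' N y : ℕ} (hy : 5 * N < y) (h : (chainG N').Adj (5 * N) y) : y = 5 * N + 1 := by
  rw [chainG_adj, chainRelB_iff, chainRelB_iff] at h
  omega

/-- No edge jumps over a connector. [folklore] -/
theorem not_adj_across {N' N u v : ℕ} (hu : u < 5 * N) (hv : 5 * N < v) : ¬ (chainG N').Adj u v := by
  intro h
  rw [chainG_adj, chainRelB_iff, chainRelB_iff] at h
  omega

/-- The only neighbour of the start vertex is `1`. [folklore] -/
theorem eq_one_of_adj_zero {N' y : ℕ} (h : (chainG N').Adj 0 y) : y = 1 := by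
  rw [chainG_adj, chainRelB_iff, chainRelB_iff] at h
  omega

/-- The Hamiltonian paths of the last cell from its `p` to its `q`. [folklore] -/
theorem cell_cases {N' N : ℕ} {y : ℕ} {l : List ℕ}
    (h : IsHamPathOn (chainG N') (Finset.Ico (5 * N + 1) (5 * N + 5)) y (5 * N + 4) l) (hy : y = 5 * N + 1) :
    l = [5 * N + 1, 5 * N + 2, 5 * N + 3, 5 * N + 4] ∨ l = [5 * N + 1, 5 * N + 3, 5 * N + 2, 5 * N + 4] := by
  subst hy
  refine h.eq_of_card_four ?_ (by omega) (by omega) (by omega) (by omega) (by omega) (by omega)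
  ext v
  simp only [Finset.mem_Ico, Finset.mem_insert, Finset.mem_singleton]
  omega

/-- **Every Hamiltonian `s`–`t` path of the chain is the path of a state vector.** [folklore] -/
theorem exists_eq_pathOf : ∀ {N : ℕ} (_ : 0 < N) {l : List ℕ},
    IsHamPathOn (chainG N) (chainV N) 0 (5 * N - 1) l → ∃ σ : Fin N → Bool, l = pathOf N (extB σ)
  | 0, hN, _, _ => absurd hN (lt_irrefl 0)
  | 1, _, l, h => by
    -- one cell: `l = 0 :: l₂` with `l₂` a Hamiltonian path of `{1,2,3,4}` from `1` to `4`
    obtain ⟨hnd, hV, hhead, hlast, hchain⟩ := h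
    obtain ⟨u, l₂, rfl⟩ : ∃ u l₂, l = u :: l₂ := by
      cases l with
      | nil => simp at hhead
      | cons u l₂ => exact ⟨u, l₂, rfl⟩
    simp only [List.head?_cons, Option.some.injEq] at hhead
    subst hhead
    have h2 : l₂ ≠ [] := by rintro rfl; simp at hlast
    obtain ⟨y, r, rfl⟩ := List.exists_cons_of_ne_nil h2
    have hy : y = 1 := eq_one_of_adj_zero (List.isChain_cons_cons.1 hchain).1
    have hl₂ : IsHamPathOn (chainG 1) (Finset.Ico (5 * 0 + 1) (5 * 0 + 5)) y (5 * 0 + 4) (y :: r) := by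
      refine ⟨(List.nodup_cons.1 hnd).2, ?_, rfl, by simpa using hlast, (List.isChain_cons_cons.1 hchain).2⟩
      ext v
      have hv : v ∈ (0 :: y :: r).toFinset ↔ v ∈ chainV 1 := by rw [hV]
      simp only [List.toFinset_cons, Finset.mem_insert, List.mem_toFinset, chainV, Finset.mem_range] at hv
      simp only [List.toFinset_cons, Finset.mem_insert, List.mem_toFinset, Finset.mem_Ico]
      have h0 : (0 : ℕ) ∉ y :: r := (List.nodup_cons.1 hnd).1
      constructor
      · intro hmem
        have : v ≠ 0 := by rintro rfl; exact h0 (by simpa using hmem)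
        have := hv.1 (Or.inr hmem)
        omega
      · intro hmem
        rcases hv.2 (by omega) with rfl | hmem'
        · omega
        · exact hmem'
    rcases cell_cases hl₂ hy with hl | hl
    · exact ⟨fun _ => true, by rw [hl]; decide⟩
    · exact ⟨fun _ => false, by rw [hl]; decide⟩
  | N + 2, _, l, h => by
    have hN : 0 < N + 1 := Nat.succ_pos N
    -- cut at the last connector `5(N+1)`
    have hsplit := h.split (A := Finset.range (5 * (N + 1))) (B := Finset.Ico (5 * (N + 1) + 1) (5 * (N + 1) + 5))
      (c := 5 * (N + 1)) (fun v => by simp only [chainV, Finset.mem_range, Finset.mem_Ico]; omega)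
      (by rw [Finset.disjoint_left]; intro v hv hv'; simp only [Finset.mem_range, Finset.mem_Ico] at hv hv'; omega)
      (by simp) (by simp) (by simp) (by simp only [Finset.mem_Ico]; omega)
      (fun a ha b hb => by
        simp only [Finset.mem_range, Finset.mem_Ico] at ha hb
        exact not_adj_across ha (by omega))
    obtain ⟨l₁, l₂, x, y, rfl, h₁, h₂, hx, hy⟩ := hsplit
    -- the left piece is a Hamiltonian path of the shorter chain
    have hx' : x = 5 * (N + 1) - 1 :=
      eq_of_adj_connector_left (by simpa [Finset.mem_range] using h₁.end_mem) hx
    subst hx'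
    have h₁' : IsHamPathOn (chainG (N + 1)) (chainV (N + 1)) 0 (5 * (N + 1) - 1) l₁ :=
      h₁.mono fun a ha b hb hab => (chainG_adj_mono (N' := N + 2) (by omega) (by simpa [Finset.mem_range] using ha)
        (by simpa [Finset.mem_range] using hb)).2 hab
    obtain ⟨σ', rfl⟩ := exists_eq_pathOf hN h₁'
    -- the right piece is one of the two traversals of the last cell
    have hy' : y = 5 * (N + 1) + 1 :=
      eq_of_adj_connector_right (by have := h₂.start_mem; simp only [Finset.mem_Ico] at this; omega) hy
    have h₂' : IsHamPathOn (chainG (N + 2)) (Finset.Ico (5 * (N + 1) + 1) (5 * (N + 1) + 5)) y (5 * (N + 1) + 4) l₂ := by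
      have : 5 * (N + 2) - 1 = 5 * (N + 1) + 4 := by omega
      rwa [this] at h₂
    let b : Bool := decide (l₂ = [5 * (N + 1) + 1, 5 * (N + 1) + 2, 5 * (N + 1) + 3, 5 * (N + 1) + 4])
    refine ⟨fun i => if h : i.val < N + 1 then σ' ⟨i.val, h⟩ else b, ?_⟩
    rw [show N + 2 = N + 1 + 1 from rfl, pathOf_succ (N + 1)]
    have hagree : pathOf (N + 1) (extB σ') =
        pathOf (N + 1) (extB fun i : Fin (N + 2) => if h : i.val < N + 1 then σ' ⟨i.val, h⟩ else b) :=
      pathOf_congr fun i hi => by simp [extB, hi, Nat.lt_succ_of_lt hi]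
    rw [← hagree]
    have hlast : extB (fun i : Fin (N + 2) => if h : i.val < N + 1 then σ' ⟨i.val, h⟩ else b) (N + 1) = b := by
      simp [extB]
    rw [hlast]
    rcases cell_cases h₂' hy' with hl | hl
    · have hb : b = true := by simp [b, hl]
      rw [hb, hl]
      simp
    · have hb : b = false := by simp [b, hl]
      rw [hb, hl]
      simp

/-- **The Hamiltonian `s`–`t` paths of the chain are exactly the paths of the state vectors.**
[folklore] -/
theorem isHamPathOn_iff {N : ℕ} (hN : 0 < N) {l : List ℕ} :
    IsHamPathOn (chainG N) (chainV N) 0 (5 * N - 1) l ↔ ∃ σ : Fin N → Bool, l = pathOf N (extB σ) :=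
  ⟨exists_eq_pathOf hN, by rintro ⟨σ, rfl⟩; exact isHamPathOn_pathOf hN _⟩

/-- Distinct state vectors give distinct paths. [folklore] -/
theorem pathOf_extB_injective (N : ℕ) : Function.Injective fun σ : Fin N → Bool => pathOf N (extB σ) := by
  intro σ σ' h
  funext ⟨i, hi⟩
  have hlen : 5 * i + 2 < (pathOf N (extB σ)).length := by rw [length_pathOf]; omega
  have := congrArg (fun l : List ℕ => l[5 * i + 2]?) h
  simp only at this
  rw [List.getElem?_eq_getElem hlen, List.getElem?_eq_getElem (by rw [length_pathOf]; omega), getElem_pathOf,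
    getElem_pathOf, Option.some.injEq] at this
  unfold chainPerm at this
  have hm : (5 * i + 2) % 5 = 2 := by omega
  have hd : (5 * i + 2) / 5 = i := by omega
  simp only [hm, ↓reduceIte, hd, extB, hi, ↓reduceDIte] at this
  cases h1 : σ ⟨i, hi⟩ <;> cases h2 : σ' ⟨i, hi⟩ <;> simp_all

/-! ### Counting with required and forbidden edges -/

/-- **The constrained Hamiltonian-path counts of the chain are numbers of state vectors.**
[folklore] -/
theorem hamCountRF_chain_eq_card {N : ℕ} (hN : 0 < N) (R F : Finset (ℕ × ℕ)) :
    hamCountRF (chainG N) (chainV N) 0 (5 * N - 1) R F =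
      (Finset.univ.filter fun σ : Fin N → Bool =>
        (∀ e ∈ R, Uses (pathOf N (extB σ)) e) ∧ ∀ e ∈ F, ¬ Uses (pathOf N (extB σ)) e).card := by
  classical
  have hset : hamSetRF (chainG N) (chainV N) 0 (5 * N - 1) R F =
      (fun σ : Fin N → Bool => pathOf N (extB σ)) ''
        ↑(Finset.univ.filter fun σ : Fin N → Bool =>
          (∀ e ∈ R, Uses (pathOf N (extB σ)) e) ∧ ∀ e ∈ F, ¬ Uses (pathOf N (extB σ)) e) := by
    ext l
    simp only [hamSetRF, Set.mem_setOf_eq, Set.mem_image, Finset.coe_filter, Finset.mem_univ, true_and]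
    constructor
    · rintro ⟨hham, hR, hF⟩
      obtain ⟨σ, rfl⟩ := exists_eq_pathOf hN hham
      exact ⟨σ, ⟨hR, hF⟩, rfl⟩
    · rintro ⟨σ, ⟨hR, hF⟩, rfl⟩
      exact ⟨isHamPathOn_pathOf hN _, hR, hF⟩
  rw [hamCountRF, hset, Set.ncard_image_of_injective _ (pathOf_extB_injective N), Set.ncard_coe_finset]

/-! ### Which slot edges the path of a state vector uses -/

/-- Positions of vertices on the path of a state vector. [folklore] -/
theorem getElem_pathOf_eq_iff {N : ℕ} {τ : ℕ → Bool} {j v : ℕ} (hj : j < (pathOf N τ).length) :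
    (pathOf N τ)[j] = v ↔ j = chainPerm τ v := by
  rw [getElem_pathOf]
  constructor
  · rintro rfl; rw [chainPerm_chainPerm]
  · rintro rfl; rw [chainPerm_chainPerm]

/-- When a pair of vertices is consecutive on the path of a state vector. [folklore] -/
theorem pair_infix_pathOf_iff {N : ℕ} {τ : ℕ → Bool} {x y : ℕ} :
    [x, y] <:+: pathOf N τ ↔ chainPerm τ x + 1 < 5 * N ∧ chainPerm τ (chainPerm τ x + 1) = y := by
  rw [pair_infix_iff]
  constructor
  · rintro ⟨j, hj, h1, h2⟩
    rw [getElem_pathOf_eq_iff] at h1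
    subst h1
    rw [length_pathOf] at hj
    exact ⟨hj, by rw [getElem_pathOf] at h2; exact h2⟩
  · rintro ⟨h1, h2⟩
    refine ⟨chainPerm τ x, by rw [length_pathOf]; exact h1, ?_, ?_⟩
    · rw [getElem_pathOf, chainPerm_chainPerm]
    · rw [getElem_pathOf, h2]

/-- The position permutation on the vertices of a cell. [folklore] -/
theorem chainPerm_cell (τ : ℕ → Bool) (i : ℕ) :
    chainPerm τ (5 * i) = 5 * i ∧ chainPerm τ (5 * i + 1) = 5 * i + 1 ∧ chainPerm τ (5 * i + 4) = 5 * i + 4 ∧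
      chainPerm τ (5 * i + 2) = (if τ i then 5 * i + 2 else 5 * i + 3) ∧
      chainPerm τ (5 * i + 3) = (if τ i then 5 * i + 3 else 5 * i + 2) := by
  unfold chainPerm
  have h0 : (5 * i) % 5 = 0 := by omega
  have h1 : (5 * i + 1) % 5 = 1 := by omega
  have h2 : (5 * i + 2) % 5 = 2 := by omega
  have h3 : (5 * i + 3) % 5 = 3 := by omega
  have h4 : (5 * i + 4) % 5 = 4 := by omega
  have d2 : (5 * i + 2) / 5 = i := by omega
  have d3 : (5 * i + 3) / 5 = i := by omega
  refine ⟨by rw [if_neg (by omega), if_neg (by omega)], by rw [if_neg (by omega), if_neg (by omega)],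
    by rw [if_neg (by omega), if_neg (by omega)], by rw [if_pos h2, d2], ?_⟩
  rw [if_neg (by omega), if_pos h3, d3]
  cases τ i <;> simp

/-- **The edge `p–a` of cell `i` is used iff `σ i`.** [folklore] -/
theorem uses_pathOf_pa {N : ℕ} {τ : ℕ → Bool} {i : ℕ} (hi : i < N) :
    Uses (pathOf N τ) (5 * i + 1, 5 * i + 2) ↔ τ i = true := by
  obtain ⟨-, c1, c4, c2, c3⟩ := chainPerm_cell τ i
  unfold Uses
  simp only []
  rw [pair_infix_pathOf_iff, pair_infix_pathOf_iff]
  cases hτ : τ i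
  · simp only [hτ, Bool.false_eq_true, ↓reduceIte] at c2 c3
    rw [c1, show 5 * i + 1 + 1 = 5 * i + 2 from rfl, c2, show 5 * i + 3 + 1 = 5 * i + 4 from rfl, c4]
    simp only [Bool.false_eq_true, iff_false, not_or, not_and]
    constructor <;> intro <;> omega
  · simp only [hτ, ↓reduceIte] at c2 c3
    rw [c1, show 5 * i + 1 + 1 = 5 * i + 2 from rfl, c2]
    simp only [iff_true, and_true]
    exact Or.inl (by omega)

/-- **The edge `b–q` of cell `i` is used iff `σ i`.** [folklore] -/
theorem uses_pathOf_bq {N : ℕ} {τ : ℕ → Bool} {i : ℕ} (hi : i < N) :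
    Uses (pathOf N τ) (5 * i + 3, 5 * i + 4) ↔ τ i = true := by
  obtain ⟨-, -, c4, c2, c3⟩ := chainPerm_cell τ i
  obtain ⟨c0', -, -, -, -⟩ := chainPerm_cell τ (i + 1)
  unfold Uses
  simp only []
  rw [pair_infix_pathOf_iff, pair_infix_pathOf_iff]
  cases hτ : τ i
  · simp only [hτ, Bool.false_eq_true, ↓reduceIte] at c2 c3
    rw [c3, show 5 * i + 2 + 1 = 5 * i + 3 from rfl, c3, c4, show 5 * i + 4 + 1 = 5 * (i + 1) by omega, c0']
    simp only [Bool.false_eq_true, iff_false, not_or, not_and]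
    constructor <;> intro <;> omega
  · simp only [hτ, ↓reduceIte] at c2 c3
    rw [c3, show 5 * i + 3 + 1 = 5 * i + 4 from rfl, c4]
    simp only [iff_true, and_true]
    exact Or.inl (by omega)

/-- **The edge `p–b` of cell `i` is used iff `¬ σ i`.** [folklore] -/
theorem uses_pathOf_pb {N : ℕ} {τ : ℕ → Bool} {i : ℕ} (hi : i < N) :
    Uses (pathOf N τ) (5 * i + 1, 5 * i + 3) ↔ τ i = false := by
  obtain ⟨-, c1, c4, c2, c3⟩ := chainPerm_cell τ i
  unfold Uses
  simp only []
  rw [pair_infix_pathOf_iff, pair_infix_pathOf_iff]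
  cases hτ : τ i
  · simp only [hτ, Bool.false_eq_true, ↓reduceIte] at c2 c3
    rw [c1, show 5 * i + 1 + 1 = 5 * i + 2 from rfl, c2]
    simp only [iff_true, and_true]
    exact Or.inl (by omega)
  · simp only [hτ, ↓reduceIte] at c2 c3
    rw [c1, show 5 * i + 1 + 1 = 5 * i + 2 from rfl, c2, c3, show 5 * i + 3 + 1 = 5 * i + 4 from rfl, c4]
    simp only [Bool.true_eq_false, iff_false, not_or, not_and]
    constructor <;> intro <;> omega

/-- **The edge `a–q` of cell `i` is used iff `¬ σ i`.** [folklore] -/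
theorem uses_pathOf_aq {N : ℕ} {τ : ℕ → Bool} {i : ℕ} (hi : i < N) :
    Uses (pathOf N τ) (5 * i + 2, 5 * i + 4) ↔ τ i = false := by
  obtain ⟨-, -, c4, c2, c3⟩ := chainPerm_cell τ i
  obtain ⟨c0', -, -, -, -⟩ := chainPerm_cell τ (i + 1)
  unfold Uses
  simp only []
  rw [pair_infix_pathOf_iff, pair_infix_pathOf_iff]
  cases hτ : τ i
  · simp only [hτ, Bool.false_eq_true, ↓reduceIte] at c2 c3
    rw [c2, show 5 * i + 3 + 1 = 5 * i + 4 from rfl, c4]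
    simp only [iff_true, and_true]
    exact Or.inl (by omega)
  · simp only [hτ, ↓reduceIte] at c2 c3
    rw [c2, show 5 * i + 2 + 1 = 5 * i + 3 from rfl, c3, c4, show 5 * i + 4 + 1 = 5 * (i + 1) by omega, c0']
    simp only [Bool.true_eq_false, iff_false, not_or, not_and]
    constructor <;> intro <;> omega

end Literature.Combinatorics.SimpleGraph
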